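import Summits.ResolutionOfSingularities.ResolutionOfSingularities.Theorems.PurelyInseparableDim4Scope
import Literature.AlgebraicGeometry.Resolution.CentreBlowupOrdAlongBasics
import Literature.AlgebraicGeometry.Resolution.PointBlowupKangaroo
import Literature.AlgebraicGeometry.Resolution.OrdZeroBasics
import HarnessLib

/-!
# MODE 0 (points only) never terminates on class (4,1): the infinite EQUAL plateau of the Whitney-umbrella cylinder

[OURS · negative result about OUR candidate frame (the calibration mode MODE 0 of
`PurelyInseparableDim4Target`) — nothing about resolution of singularities; counted 0.]
Census cell «res-dim4-pi» (D-0157 DOOR 2); the typed reason why MODE 0 is «calibration only»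
(desk WORD #10) and the simplest member of the C-001 / Z28 family (Hauser–Perlega PRIMS 60 §7
Example 2, the Whitney-umbrella cylinder `z^q + yw^q`, singular locus `V(z, w)` NON-ISOLATED):

for every exponent `q ≥ 2`, every field `K` and every `a : ℕ`, the presented state
`s a = (F = x^a·y·w^q, r = (x ↦ a, y ↦ 1), exc = {x, y})` (shade `2`... in general `q`: residual
`y·w^q`, shade `q`) is `q`-fold at the origin, and the ORIGIN of the `x`-chart of the POINT blow-up
is again such a state: `CentreBlowup.step q univ x 0 (s a) = s (a + 1)` (chart law `x^a ↦ x^{a+1}`,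
no translation, nothing to clean since the `y`-exponent is `1`, the component `x` gets multiplicity
`(a + 1 + q) − q = a + 1`).  Hence `k ↦ s k` is an infinite chain of `Step0 q` edges over ANY field:
the point-blow-up walk runs for ever along the curve of `q`-fold points with constant shade (an
EQUAL plateau; the engines' `TERMINATED:nonear`-free branch `x-chart origin^∞` of Z28 after depth 2).
Consequences for frame v4 (`PurelyInseparableDim4Scope`): the clause `IsIsolated` of F4-I
`NoIsolatedTrap p q` is load-bearing (without it infinite `Step0` branches exist for every `p`), and
the POINT rule loses the SPINE game: `not_spineTerminatesUnder_point` (every edge of the chain is a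
chart-origin edge).  Variables `(x, y, w, u) = Fin 4`; `u` is a dummy.  Nothing here proves or
disproves resolution of singularities in dim ≥ 4 / char p.
-/

-- house layout `Summits/<Summit>/<Problem>` doubles the namespace component (as in the Target file)
set_option linter.dupNamespace false

noncomputable section

namespace Summit.ResolutionOfSingularities.ResolutionOfSingularities.Theorems.PIDim4

namespace Mode0Plateau

open MvPolynomial Finset
open Literature.AlgebraicGeometry.Resolution
open Literature.AlgebraicGeometry.Resolution.Hauser2010
open Literature.AlgebraicGeometry.Resolution.CentreBlowup

variable {K : Type} [Field K]

/-- exponent of `x^a·y·w^q`. [folklore] -/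
def e (q a : ℕ) : Fin 4 →₀ ℕ := Finsupp.single 0 a + Finsupp.single 1 1 + Finsupp.single 2 q
/-- multiplicities `(x ↦ a, y ↦ 1)`. [folklore] -/
def r (a : ℕ) : Fin 4 →₀ ℕ := Finsupp.single 0 a + Finsupp.single 1 1

/-- `e q a` coordinatewise. [folklore] -/
theorem e_apply (q a : ℕ) (i : Fin 4) : e q a i = ![a, 1, q, 0] i := by
  fin_cases i <;> simp [e]
/-- `r a` coordinatewise. [folklore] -/
theorem r_apply (a : ℕ) (i : Fin 4) : r a i = ![a, 1, 0, 0] i := by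
  fin_cases i <;> simp [r]

variable (K) in
/-- the state `s a = (x^a·y·w^q, (x ↦ a, y ↦ 1), {x, y})` on the Whitney-umbrella cylinder's
MODE-0 branch. [folklore] -/
def s (q a : ℕ) : State K := ⟨monomial (e q a) 1, r a, {0, 1}⟩

/-- `Σ_{all} (e q a) = a + 1 + q`. [folklore] -/
theorem degIn_univ_e (q a : ℕ) : degIn Finset.univ (e q a) = a + 1 + q := by
  rw [degIn_univ, Finsupp.degree_eq_sum, Fin.sum_univ_four]; simp [e_apply]

/-- `ord_{(x,y,w,u)} (x^a y w^q) = a + 1 + q`. [folklore] -/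
theorem ordAlong_s (q a : ℕ) : ordAlong Finset.univ (s K q a).F = ((a + 1 + q : ℕ) : ℕ∞) := by
  show ordAlong Finset.univ (monomial (e q a) (1 : K)) = _
  rw [ordAlong_monomial _ _ one_ne_zero, degIn_univ_e]

/-- chart law at the `x`-chart of the point blow-up: `x^a y w^q ↦ x^{a+1} y w^q`. [folklore] -/
theorem chartExponent_e (q a : ℕ) : chartExponent q Finset.univ 0 (e q a) = e q (a + 1) := by
  rw [chartExponent_eq_iff, degIn_univ_e]
  refine ⟨by simp [e_apply], fun i hi => ?_⟩
  fin_cases i <;> simp_all [e_apply]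

/-- `x^{a+1} y w^q` is not a `q`-th power monomial (`q ≥ 2` does not divide the `y`-exponent `1`). [folklore] -/
theorem not_isPthPowerExponent_e {q : ℕ} (hq : 2 ≤ q) (a : ℕ) : ¬ IsPthPowerExponent q (e q a) := by
  intro h
  have := (isPthPowerExponent_iff q _).mp h 1
  rw [e_apply] at this
  have : q ≤ 1 := Nat.le_of_dvd one_pos (by simpa using this)
  omega

/-- the transform at the origin of the `x`-chart (before cleaning). [folklore] -/
theorem pointTransform_s [DecidableEq K] (q a : ℕ) :
    pointTransform q Finset.univ 0 0 (s K q a) = monomial (e q (a + 1)) 1 := by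
  rw [pointTransform, PointBlowup.translate_zero]
  show chartTransform q Finset.univ 0 (monomial (e q a) (1 : K)) = _
  rw [chartTransform_monomial, chartExponent_e]

/-- **One MODE-0 step along the plateau**: `s a ⟶ s (a+1)` at the origin of the `x`-chart. [folklore] -/
theorem step_s [DecidableEq K] {q : ℕ} (hq : 2 ≤ q) (a : ℕ) :
    CentreBlowup.step q Finset.univ 0 0 (s K q a) = s K q (a + 1) := by
  have hF : deletePthPowers q (pointTransform q Finset.univ 0 0 (s K q a)) = monomial (e q (a + 1)) 1 := by
    rw [pointTransform_s, deletePthPowers_monomial, if_neg (not_isPthPowerExponent_e hq (a + 1))]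
  have hr : newMult q Finset.univ 0 0 (s K q a) = r (a + 1) := by
    unfold newMult
    rw [ordAlong_s, ENat.toNat_coe, show (s K q a).r = r a from rfl]
    ext i
    rw [Finsupp.update_apply, Finsupp.filter_apply, r_apply, r_apply]
    fin_cases i <;> simp
  have he : newExc 0 0 (s K q a) = ({0, 1} : Finset (Fin 4)) := by
    unfold newExc
    show insert (0 : Fin 4) (Finset.filter (fun i => (0 : Fin 4 → K) i = 0) {0, 1}) = {0, 1}
    simp
  unfold CentreBlowup.step
  rw [hF, hr, he]; rfl

/-- the origin of the `x`-chart is again a `q`-fold point. [folklore] -/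
theorem isEquimultiplePoint_s [DecidableEq K] (q a : ℕ) : IsEquimultiplePoint q Finset.univ 0 0 (s K q a) := by
  intro d _ hd
  rw [pointTransform_s, coeff_monomial, if_neg]
  intro h
  rw [← h, ← degIn_univ, degIn_univ_e] at hd
  omega

/-- **`s a ⟶ s (a+1)` is a MODE-0 (point blow-up) step** for every `q ≥ 2`. [folklore] -/
theorem step0_s [DecidableEq K] {q : ℕ} (hq : 2 ≤ q) (a : ℕ) : Step0 q (s K q a) (s K q (a + 1)) := by
  refine ⟨by rw [ordAlong_s]; exact_mod_cast (by omega : q ≤ a + 1 + q), 0, 0, Finset.mem_univ _, rfl,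
    isEquimultiplePoint_s q a, ?_, (step_s hq a).symm⟩
  rw [step_s hq a]
  exact (monomial_eq_zero).not.mpr one_ne_zero

/-- the shade is constant `= q` along the plateau (`(a + 1 + q) − (a + 1)`): every edge is EQUAL. [folklore] -/
theorem shade_s (q a : ℕ) : (s K q a).shade = q := by
  show ordZero (monomial (e q a) (1 : K)) - ((r a).degree : ℕ∞) = q
  have hr : (r a).degree = a + 1 := by rw [Finsupp.degree_eq_sum, Fin.sum_univ_four]; simp [r_apply]
  rw [ordZero_monomial _ one_ne_zero, ← degIn_univ, degIn_univ_e, hr, ← ENat.coe_sub]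
  congr 1; omega

/-- consecutive plateau states are EQUAL edges (`EqualD`). [folklore] -/
theorem equalD_s (q a : ℕ) : EqualD (s K q a) (s K q (a + 1)) := by
  show (s K q (a + 1)).shade = (s K q a).shade
  rw [shade_s, shade_s]

end Mode0Plateau

open Mode0Plateau in
/-- **MODE 0 does not terminate on class (4,1)**, for every exponent `q ≥ 2` and over EVERY field:
the states `(x^a·y·w^q, (x ↦ a, y ↦ 1), {x,y})`, `a = 0, 1, 2, …` form an infinite chain of
point-blow-up steps (`x`-chart origins along the non-isolated `q`-fold curve of the Whitney-umbrella
cylinder `z^q + yw^q`; shade constantly `q`).  Typed reason why MODE 0 is calibration-only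
(WORD #10); KNOWN (Hauser–Perlega PRIMS 60 §7 Ex. 2 / JUMPS C-001, Z28).  Nothing about resolution of
singularities. [folklore] -/
theorem exists_infinite_step0_chain {q : ℕ} (hq : 2 ≤ q) (K : Type) [Field K] [DecidableEq K] :
    ∃ c : ℕ → State K, ∀ k, Step0 q (c k) (c (k + 1)) :=
  ⟨fun k => s K q k, fun k => step0_s hq k⟩

open Mode0Plateau in
/-- In particular at the class of record `p = q = 2` over `𝔽₂`. [folklore] -/
theorem exists_infinite_step0_chain_two : ∃ c : ℕ → State (ZMod 2), ∀ k, Step0 2 (c k) (c (k + 1)) :=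
  exists_infinite_step0_chain le_rfl (ZMod 2)

open Mode0Plateau in
/-- **F4-I needs its isolation clause**: without `IsIsolated`, «no infinite `Step0` branch» fails over
every field (so `NoIsolatedTrap p q` is a statement about ISOLATED `q`-fold points only). [folklore] -/
theorem exists_infinite_step0_chain_of_charP {q : ℕ} (hq : 2 ≤ q) (p : ℕ) (K : Type) [Field K]
    [CharP K p] [DecidableEq K] : ∃ c : ℕ → State K, ∀ k, Step0 q (c k) (c (k + 1)) :=
  exists_infinite_step0_chain hq K

open Mode0Plateau in
/-- **The POINT rule loses the SPINE game** (frame v4): always blowing up the point (`R ≡ univ`) has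
an infinite branch of chart-ORIGIN edges, for every `q ≥ 2` over every field. [folklore] -/
theorem not_spineTerminatesUnder_point {q : ℕ} (hq : 2 ≤ q) (K : Type) [Field K] [DecidableEq K] :
    ¬ SpineTerminatesUnder q (fun _ : State K => Finset.univ) := by
  intro h
  refine h ⟨fun k => s K q k, fun k => ⟨⟨Finset.univ_nonempty, ?_⟩, 0, Finset.mem_univ _,
    isEquimultiplePoint_s q k, ?_, (step_s hq k).symm⟩⟩
  · rw [ordAlong_s]; exact_mod_cast (by omega : q ≤ k + 1 + q)
  · rw [step_s hq k]; exact (MvPolynomial.monomial_eq_zero).not.mpr one_ne_zero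

end Summit.ResolutionOfSingularities.ResolutionOfSingularities.Theorems.PIDim4

end
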